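import Summits.NavierStokesRegularity.NavierStokesRegularity.Theorems.FluidComputerCascade
import Summits.NavierStokesRegularity.NavierStokesRegularity.Theorems.PerpetualPumpThesisBesovFloorBoundDuhamel
import HarnessLib

/-!
# Fluid computer blueprint — CALIBRATION: a cascade witness is finite-time `H¹` blow-up, no more

HONEST FRAMING: low prior, high value-of-information experiment on Tao's machine paradigm; NOT a
claim that NS blows up. Nothing here constructs a cascade witness; this file MEASURES how much of
Tao's machine programme (J. Amer. Math. Soc. 29 (2016), §1.3) the Lean interface
`Literature.Analysis.FluidPDE.FluidComputer.CascadeWitness` encodes. Answer: nothing beyond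
finite-time blow-up itself.

* `blowupProfile_of_cascadeWitness` (forward; the Literature file's Theorem B with the in-tree
  `h10MildTheory_holds`): the datum of a cascade witness has a MAXIMAL `H¹⁰_df`-mild Navier–Stokes
  solution with finite lifespan `S_m ≤ T_* = ∑ T_n`, no mild extension, and unbounded `H¹⁰` norm.
* `exists_cascadeWitness_of_blowup` (converse, new): if the maximal `H¹⁰_df`-mild Navier–Stokes
  solution `U` from a Schwartz divergence-free datum `u₀` lives on `[0, S_m)`, admits no mild
  extension, and `‖U(t)‖²_{H¹} → ∞` as `t ↑ S_m`, then there IS a cascade witness with datum `u₀`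
  and `T_* ≤ S_m`: stages `U([t_n, S_m))` (tail segments of the trajectory), allowances
  `T_n = t_{n+1} - t_n` (telescoping, hence summable), floors `n`, where `‖U‖²_{H¹} ≥ n` on
  `[t_n, S_m)`. The realisation axiom `fires` then holds because every mild trajectory from `u₀`
  is an initial segment of `U` (uniqueness) and because `U` is INJECTIVE on `[0, S_m)`.
* `injOn_of_noExtension` (new, any averaging datum): a mild trajectory on `[0, S_m)` with no mild
  extension never self-intersects — if `U t₁ = U t₂` with `t₁ < t₂`, the time-translate of `U` from
  `t₁` (`timeShift`, a mild solution from `U t₁ = U t₂`, via the restarted Duhamel identity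
  `PerpetualPumpThesis.F.pairing_eq_restart`) glued at `t₂` (`PerpetualPumpThesis.stub_restart`)
  is, by uniqueness (`PerpetualPumpThesis.stub_uniqueness`), an extension of `U` past `S_m`.

THE GAP between the two directions is `limsup_{t ↑ S_m} ‖U(t)‖_{H¹⁰} = ∞` (forward) versus
`lim_{t ↑ S_m} ‖U(t)‖_{H¹} = ∞` (converse). For the true Navier–Stokes equations it is closed by
classical facts NOT formalised in the tree (Leray 1934: `‖∇u(t)‖_{L²} ≥ c ν^{3/4} (T_* - t)^{-1/4}`
before a first singular time of a smooth finite-energy solution; `H¹` controls `H¹⁰` continuation).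
So, up to those classical facts, `Nonempty CascadeWitness` is EQUIVALENT to "some Schwartz
divergence-free datum has an `H¹⁰_df`-mild Navier–Stokes solution blowing up in finite time": the
soft assembly `CascadeWitness → ¬ NavierStokesRegularity` (`FluidComputerCascade.lean`) is a
near-tautology, and ALL of Tao's programme (fluid logic gates, a self-replicating architecture,
noise tolerance, abruptness beating viscosity) lives in CONSTRUCTING the field `fires` — none of it
in using it. This is the calibration recorded in the blueprint's `ASSEMBLY.md` §2c.

## References

* T. Tao, *Finite time blowup for an averaged three-dimensional Navier–Stokes equation*, J. Amer.
  Math. Soc. 29 (2016) 601–674, arXiv:1402.0290v3, §1.1 (1.15), §1.3 pp. 10–11. [Tao2016AveragedNS]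
* J. Leray, *Sur le mouvement d'un liquide visqueux emplissant l'espace*, Acta Math. 63 (1934)
  193–248, §34 (lower bound on the blow-up rate). [Leray1934]
-/

set_option linter.dupNamespace false

noncomputable section

open Set Filter Topology
open scoped SchwartzMap ENNReal

namespace Summit.NavierStokesRegularity.NavierStokesRegularity.Theorems.FluidComputer

open Literature.Analysis.FluidPDE Literature.Analysis.FluidPDE.Tao2016
open Literature.Analysis.FluidPDE.FluidComputer
open Literature.Analysis.FunctionSpaces (eFourierSobolevNorm)

/-! ### Time translation of mild solutions -/

/-- **Time translation of mild solutions.** If `u` is a mild `H¹⁰_df` solution of the averaged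
equation of `𝒜` from `a` on `[0,T)` and `0 ≤ t₁`, then `s ↦ u (t₁ + s)` is a mild solution from
`u t₁` on `[0, T - t₁)` (empty, hence vacuous, unless `t₁ < T`): the restarted Duhamel identity
(`F.pairing_eq_restart`) after the substitution `σ = t₁ + s`. -/
theorem timeShift (𝒜 : AveragingDatum) {a : L2C} {T t₁ : ℝ} {u : ℝ → L2C}
    (hu : IsMildSolutionFor 𝒜.form a (Ico 0 T) u) (ht₁ : 0 ≤ t₁) :
    IsMildSolutionFor 𝒜.form (u t₁) (Ico 0 (T - t₁)) (fun s => u (t₁ + s)) := by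
  have hmaps : MapsTo (fun s => t₁ + s) (Ico 0 (T - t₁)) (Ico 0 T) := fun s hs =>
    ⟨by linarith [hs.1], by linarith [hs.2]⟩
  refine ⟨fun s hs => hu.1 _ (hmaps hs), fun s₀ hs₀ => ?_, fun s hs w hw => ?_⟩
  · have hc := hu.2.1 (t₁ + s₀) (hmaps hs₀)
    have hφ : Tendsto (fun s => t₁ + s) (𝓝[Ico 0 (T - t₁)] s₀) (𝓝[Ico 0 T] (t₁ + s₀)) :=
      (continuous_const.add continuous_id).continuousWithinAt.tendsto_nhdsWithin hmaps
    exact hc.comp hφ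
  · have h := PerpetualPumpThesis.F.pairing_eq_restart 𝒜 hu ht₁ (by linarith [hs.1])
      (hmaps hs).2 hw
    rw [h, add_sub_cancel_left]
    congr 1
    have hcv := intervalIntegral.integral_comp_add_left
      (fun σ => 𝒜.form (u σ) (u σ) (heat (t₁ + s - σ) w)) t₁ (a := 0) (b := s)
    simp only [add_zero, add_sub_add_left_eq_sub] at hcv
    exact hcv.symm

/-! ### A non-extendable mild trajectory is injective -/

/-- **A mild trajectory with no mild extension never self-intersects.** If `U` is a mild solution
from `a` on `[0, S_m)` and no mild solution from `a` on a longer `[0, S')` agrees with `U` on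
`[0, S_m)`, then `U` is injective on `[0, S_m)`: a coincidence `U t₁ = U t₂`, `t₁ < t₂`, would make
the translate of `U` from `t₁`, glued at `t₂` (`stub_restart`), an extension of `U` (uniqueness)
living until `S_m + (t₂ - t₁)/2`. -/
theorem injOn_of_noExtension (𝒜 : AveragingDatum) {a : L2C} {Sm : ℝ} {U : ℝ → L2C}
    (hU : IsMildSolutionFor 𝒜.form a (Ico 0 Sm) U)
    (hmax : ¬ ∃ S' : ℝ, Sm < S' ∧ ∃ v : ℝ → L2C,
      IsMildSolutionFor 𝒜.form a (Ico 0 S') v ∧ ∀ t ∈ Ico 0 Sm, v t = U t) :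
    InjOn U (Ico 0 Sm) := by
  have key : ∀ ⦃t₁ t₂ : ℝ⦄, t₁ ∈ Ico 0 Sm → t₂ ∈ Ico 0 Sm → t₁ < t₂ → U t₁ = U t₂ → False := by
    intro t₁ t₂ ht₁ ht₂ hlt heq
    set τ : ℝ := Sm - (t₁ + t₂) / 2 with hτ_def
    have hτ : 0 < τ := by rw [hτ_def]; linarith [ht₁.2, ht₂.2]
    have hτlt : τ < Sm - t₁ := by rw [hτ_def]; linarith
    have hv : IsMildSolutionFor 𝒜.form (U t₂) (Icc 0 τ) (fun s => U (t₁ + s)) := by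
      rw [← heq]
      exact (timeShift 𝒜 hU ht₁.1).mono (Icc_subset_Ico_right hτlt)
    have hglue := PerpetualPumpThesis.stub_restart 𝒜 a Sm t₂ τ U (fun s => U (t₁ + s))
      ht₂.1 ht₂.2 hτ hU hv
    have hlt' : Sm < t₂ + τ := by rw [hτ_def]; linarith
    exact hmax ⟨t₂ + τ, hlt', _, hglue, fun t ht =>
      PerpetualPumpThesis.stub_uniqueness 𝒜 a Sm _ U
        (hglue.mono (Ico_subset_Ico_right hlt'.le)) hU t ht⟩
  intro t₁ ht₁ t₂ ht₂ heq
  by_contra hne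
  rcases lt_or_gt_of_ne hne with h | h
  · exact key ht₁ ht₂ h heq
  · exact key ht₂ ht₁ h heq.symm

/-! ### Forward calibration -/

/-- **Forward calibration** (Theorem B of the Literature file, unconditional on the summit side):
the datum of a cascade witness has a maximal `H¹⁰_df`-mild Navier–Stokes solution with finite
lifespan `S_m ≤ T_*`, no mild extension, and unbounded `H¹⁰` norm on `[0, S_m)`. -/
theorem blowupProfile_of_cascadeWitness (W : CascadeWitness) :
    ∃ Sm : ℝ, 0 < Sm ∧ Sm ≤ W.Tstar ∧ ∃ U : ℝ → L2C,
      IsMildSolutionFor eulerForm (schwartzL2 W.u₀) (Ico 0 Sm) U ∧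
      (¬ ∃ S' : ℝ, Sm < S' ∧ ∃ v : ℝ → L2C,
        IsMildSolutionFor eulerForm (schwartzL2 W.u₀) (Ico 0 S') v ∧ ∀ t ∈ Ico 0 Sm, v t = U t) ∧
      ∀ C : ℝ, ∃ t ∈ Ico 0 Sm, ENNReal.ofReal C < eFourierSobolevNorm 10 (U t) :=
  exists_maximal_unbounded_of_lifespan_le h10MildTheory_holds W.memH10df
    fun _ _ hu => W.lifespan_le hu

/-- **The maximal mild Navier–Stokes trajectory of a cascade witness's datum is injective.** -/
theorem injOn_of_cascadeWitness (W : CascadeWitness) :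
    ∃ Sm : ℝ, 0 < Sm ∧ Sm ≤ W.Tstar ∧ ∃ U : ℝ → L2C,
      IsMildSolutionFor eulerForm (schwartzL2 W.u₀) (Ico 0 Sm) U ∧ InjOn U (Ico 0 Sm) := by
  obtain ⟨Sm, hSm, hle, U, hU, hmax, -⟩ := blowupProfile_of_cascadeWitness W
  refine ⟨Sm, hSm, hle, U, hU, injOn_of_noExtension AveragingDatum.euler (a := schwartzL2 W.u₀)
    (by rwa [Literature.Barriers.NavierStokesRegularity.AveragedTypeI.euler_form_eq]) ?_⟩
  rwa [Literature.Barriers.NavierStokesRegularity.AveragedTypeI.euler_form_eq]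

/-! ### Converse calibration: a cascade witness from a finite-time `H¹` blow-up -/

/-- **Converse calibration.** Let `u₀` be a Schwartz divergence-free datum whose `H¹⁰_df`-mild
Navier–Stokes solution `U` on `[0, S_m)` (`S_m > 0`) admits no mild extension and satisfies
`‖U(t)‖²_{H¹} → ∞` as `t ↑ S_m` (for every `C`, `‖U(s)‖²_{H¹} ≥ C` on some `[τ, S_m)`). Then there
is a cascade witness with datum `u₀` and `T_* ≤ S_m`. HONEST READING: the interface
`CascadeWitness` therefore carries no "machine" content beyond finite-time blow-up; all of Tao's
programme is in constructing `fires`. -/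
theorem exists_cascadeWitness_of_blowup
    (u₀ : 𝓢(EuclideanSpace ℝ (Fin 3), EuclideanSpace ℝ (Fin 3)))
    (hdiv : VectorCalculus.IsDivFree ⇑u₀) {Sm : ℝ} (hSm : 0 < Sm) {U : ℝ → L2C}
    (hU : IsMildSolutionFor eulerForm (schwartzL2 u₀) (Ico 0 Sm) U)
    (hmax : ¬ ∃ S' : ℝ, Sm < S' ∧ ∃ v : ℝ → L2C,
      IsMildSolutionFor eulerForm (schwartzL2 u₀) (Ico 0 S') v ∧ ∀ t ∈ Ico 0 Sm, v t = U t)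
    (hblow : ∀ C : ℝ, ∃ τ : ℝ, τ < Sm ∧ ∀ s : ℝ, τ ≤ s → s < Sm →
      ENNReal.ofReal C ≤ eFourierSobolevNorm 1 (U s) ^ 2) :
    ∃ W : CascadeWitness, W.u₀ = u₀ ∧ W.Tstar ≤ Sm := by
  classical
  have h10 : MemH10df (schwartzL2 u₀) := PumpContinuationSchwartzData.memH10df_schwartzL2 u₀ hdiv
  -- injectivity of the maximal trajectory (Euler averaging datum = true Navier–Stokes form)
  have hinj : InjOn U (Ico 0 Sm) := by
    refine injOn_of_noExtension AveragingDatum.euler (a := schwartzL2 u₀)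
      (by rwa [Literature.Barriers.NavierStokesRegularity.AveragedTypeI.euler_form_eq]) ?_
    rwa [Literature.Barriers.NavierStokesRegularity.AveragedTypeI.euler_form_eq]
  -- every mild trajectory from the datum is an initial segment of `U`
  have hagree : ∀ (S : ℝ) (u : ℝ → L2C),
      IsMildSolutionFor eulerForm (schwartzL2 u₀) (Ico 0 S) u →
        S ≤ Sm ∧ ∀ t ∈ Ico 0 S, u t = U t := by
    intro S u hu
    have huniq := h10MildTheory_holds.uniqueness
    by_cases hS : S ≤ Sm
    · exact ⟨hS, fun t ht => huniq _ S u U hu (hU.mono (Ico_subset_Ico_right hS)) t ht⟩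
    · push Not at hS
      exact absurd ⟨S, hS, u, hu, fun t ht =>
        huniq _ Sm u U (hu.mono (Ico_subset_Ico_right hS.le)) hU t ht⟩ hmax
  -- the visiting schedule `t 0 = 0`, `t (n+1) = max (t n) (τ (n+1))`
  choose τ hτlt hτle using fun n : ℕ => hblow n
  let t : ℕ → ℝ := fun n => Nat.rec (motive := fun _ => ℝ) 0 (fun k tk => max tk (τ (k + 1))) n
  have t0 : t 0 = 0 := rfl
  have tsucc : ∀ n, t (n + 1) = max (t n) (τ (n + 1)) := fun n => rfl
  have tmono : Monotone t :=
    monotone_nat_of_le_succ fun n => by rw [tsucc]; exact le_max_left _ _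
  have tnn : ∀ n, 0 ≤ t n := fun n => by
    have h := tmono (Nat.zero_le n); rwa [t0] at h
  have tlt : ∀ n, t n < Sm := by
    intro n
    induction n with
    | zero => rw [t0]; exact hSm
    | succ n ih => rw [tsucc]; exact max_lt ih (hτlt _)
  have tle : ∀ n, τ (n + 1) ≤ t (n + 1) := fun n => by rw [tsucc]; exact le_max_right _ _
  have hTnn : ∀ n, 0 ≤ t (n + 1) - t n := fun n => sub_nonneg.2 (tmono n.le_succ)
  have hpartial : ∀ n, ∑ i ∈ Finset.range n, (t (i + 1) - t i) ≤ Sm := fun n => by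
    rw [Finset.sum_range_sub, t0, sub_zero]
    exact (tlt n).le
  have hsum : Summable fun n => t (n + 1) - t n := summable_of_sum_range_le hTnn hpartial
  refine ⟨{ u₀ := u₀
            divFree := hdiv
            memH10df := h10
            stage := fun n => U '' Ico (t n) Sm
            T := fun n => t (n + 1) - t n
            T_nonneg := hTnn
            summable_T := hsum
            floor := fun n => n
            tendsto_floor := tendsto_natCast_atTop_atTop
            floor_le := ?_
            ignition := ⟨0, ⟨t0.le, hSm⟩, initial_eq hU ⟨le_rfl, hSm⟩ h10⟩
            fires := ?_ }, rfl, ?_⟩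
  · -- floors: `‖U s‖²_{H¹} ≥ n` on `[t n, Sm) ⊆ [τ n, Sm)` (`n ≥ 1`; trivial for `n = 0`)
    rintro n v ⟨s, hs, rfl⟩
    cases n with
    | zero => simp
    | succ k => exact hτle (k + 1) s ((tle k).trans hs.1) hs.2
  · -- fires: the trajectory is `U`; from `U r ∈ U([t n, Sm))` and injectivity, `t n ≤ r`, and the
    -- time `max r (t (n+1)) ∈ [r, r + T n]` lies in `[t (n+1), Sm)`
    intro S u hu n r hr0 hmem hS
    obtain ⟨hSle, hagr⟩ := hagree S u hu
    have hrS : r < S := by linarith [hTnn n]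
    rw [hagr r ⟨hr0, hrS⟩] at hmem
    obtain ⟨r', hr', hUeq⟩ := hmem
    have hrr' : r' = r :=
      hinj ⟨(tnn n).trans hr'.1, hr'.2⟩ ⟨hr0, hrS.trans_le hSle⟩ hUeq
    have htn : t n ≤ r := hrr' ▸ hr'.1
    have hmax_le : max r (t (n + 1)) ≤ r + (t (n + 1) - t n) :=
      max_le (by linarith [hTnn n]) (by linarith)
    have hmS : max r (t (n + 1)) < S := hmax_le.trans_lt hS
    refine ⟨max r (t (n + 1)), le_max_left _ _, hmax_le, ?_⟩
    rw [hagr _ ⟨hr0.trans (le_max_left _ _), hmS⟩]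
    exact ⟨_, ⟨le_max_right _ _, hmS.trans_le hSle⟩, rfl⟩
  · -- `T_* = ∑ (t (n+1) - t n) ≤ Sm`
    show ∑' n, (t (n + 1) - t n) ≤ Sm
    exact Real.tsum_le_of_sum_range_le hTnn hpartial

end Summit.NavierStokesRegularity.NavierStokesRegularity.Theorems.FluidComputer

end
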